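/-
COR-CM (cells pub-hodgecm / pub-hodgecm2, stage 2 of the Hodge ladder) — TRANSPOSITION SURGE, item (vi) sub-binder S2 / (vi-2)
`supply`, PINNING RECORD, REACH HALF: TEAM hComp row U2a, THIRD FILE — **NON-VACUITY of the closed term's posited carrier
binder `C` at every face the chain reads** (hcomp-ref R-2 «exit»: `Sec42Data` instantiable from the record + [Liu2021] §2.1
Proposition (A0); x2's T1 witness by name).  Seat prover-pub-hodgecm2-b25-g38-0 (writer of row U2a, HCOMP-TABLE.md v1.3).
THEOREMS + two definitions (the compactified system and nothing else); hypothesis binders: the two NAMED FACTS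
`h : UnitaryCanonicalModel.exists_recordSystem` ([Deligne1979] 2.2.5 / Cor. 2.7.21) and `hA : Liu2021.exists_albanese`
([Liu2021] §2.1 Proposition l. 1190–1200) plus the guard `h4 : 4 ≤ [F:ℚ]` (T5 line requested on the filed sha).  Nothing in the
tree is edited or restated.  FRAMING: HC_CM is NOT proved; S2 is NOT closed; `hComp` is NOT discharged here; this file only shows
that the data binder `C` of `Model.hComp_holds` / `Model.pinReach_closed` is INHABITED fibrewise on `4 ≤ [F:ℚ]`.
-/
import Summits.HodgeConjecture.CorCM.B01.Transposition.HComp.HonestP5Of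
import Literature.NumberTheory.Automorphic.Liu2021.AppendixC.Sec42OfExistsAlbanese
import Literature.NumberTheory.Automorphic.Liu2021.AppendixC.Sec42DataCompactCase
import HarnessLib

/-!
# TEAM hComp (U2a, non-vacuity): `Sec42Data (honestP5Of h F ι₁ V Φ) iso` is inhabited for `4 ≤ [F:ℚ]`

The closed `hComp` term of TEAM hComp (`Transposition/Item6PinReachClosed.lean`, pin-1) keeps Liu's §4.2 data as a POSITED
binder `C : ∀ F ι₁ V Φ, AppendixC.Sec42Data (Model.honestP5Of h F ι₁ V Φ) (iso F ι₁ V Φ)` (hcomp-ref R-2: not constructible in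
the tree — `Sh(𝕍)_K`, Baily–Borel, Albanese).  A display over an EMPTY binder type would be vacuous; this file certifies in the
kernel that, at every face the chain reads (`6 ≤ [F:ℚ]`, here `4 ≤ [F:ℚ]`), the fibre of that Π-type is NON-EMPTY, from exactly
two cited existence theorems:

* `h : exists_recordSystem` — Deligne's canonical models `M_K` of the compact unitary Shimura surfaces (x1's record; the models
  are smooth of relative dimension `2` and PROJECTIVE over `F`, fields `RecordSystem.smooth/.projective`), hence so is
  `Sh(𝕍)_K := X_K = M_K ⊗_{F,c} F` of the honest datum (`smooth_conjSystem_obj`, `projective_conjSystem_obj` of `HonestP5.lean`,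
  moved along `recordFunctorOf_eq`): §1;
* `hA : Liu2021.exists_albanese` — [Liu2021] §2.1 Proposition (every proper smooth scheme over a field has an Albanese datum,
  Def. 2.3), consumed through the tree assembly `AppendixC.Sec42Data.nonempty_of_exists_albanese` (p303088) on the Compact-Case
  compactified system `CompactifiedSystem.ofProjective` (b11, `AppendixC/Sec42DataCompactCase.lean`, [Liu2021] l. 4656
  «If `Sh(𝕍)_K` is proper, then `S̃h(𝕍)_K = Sh(𝕍)_K`»): §2;

and the projectivity clause «projective iff Compact Case» ([Liu2021] §4.2 l. 2055–2060) holds because `d = [F⁺:ℚ] ≥ 2 ≠ 1`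
(`finrank_maximalRealSubfield_ne_one`).  END: `Model.nonempty_sec42Data_honestP5Of (h) (hA) (h4) (iso) :
Nonempty (Sec42Data (honestP5Of h F ι₁ V Φ) iso)`.  At `[F:ℚ] = 2` (never read by any hComp theorem) inhabitation is the
in-principle statement of hcomp-lead's RULING F1′ (punctured ℙ², compactified by ℙ² with one boundary point) and is NOT claimed here.

T5: binders {h, hA, h4} — line requested on the filed sha.  HC_CM is NOT proved; nothing here discharges `hComp` or B01-S.

References: [Liu2021] §2.1 Proposition l. 1190–1200, Def. 2.3, §4.2 l. 2053–2070, App. C l. 4656, Def. C.8; [Deligne1979] 2.2.5,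
Cor. 2.7.21; Q. Liu (2002) Prop. 3.1.23 / 4.3.38 (base change of projective / smooth).
-/

noncomputable section

namespace Summit.HodgeConjecture.CorCM.Model

open CategoryTheory AlgebraicGeometry NumberField
open Literature.AlgebraicGeometry.Motives
open Literature.AlgebraicGeometry.ShimuraVarieties.UnitaryCanonicalModel
open Literature.NumberTheory.Automorphic
open Literature.NumberTheory.Automorphic.Liu2021
open Literature.NumberTheory.Automorphic.Liu2021.AppendixC
open Summit.HodgeConjecture.CorCM.HComp

variable (h : exists_recordSystem) {F : CMField} {ι₁ : F →+* ℂ} (V : HermSpace3 F ι₁)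
  (Φ : Literature.AlgebraicGeometry.Motives.CMType F)

/-! ## §1  The honest system is smooth of relative dimension `2` and projective, level by level, for `4 ≤ [F:ℚ]` -/

/-- The total record functor's values are smooth of relative dimension `2` over `F` for `4 ≤ [F:ℚ]` (the chosen record's (F1)
field `RecordSystem.smooth`, along `recordFunctorOf_eq`). [cite: Deligne1979ShimuraVarieties, 2.2.5 and Cor. 2.7.21] -/
theorem smooth_recordFunctorOf_obj (h4 : 4 ≤ Module.finrank ℚ F) (K : C5.SmallLevel (K3 V)) :
    SmoothOfRelativeDimension 2 ((recordFunctorOf h V).obj K).hom := by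
  rw [recordFunctorOf_eq h V h4]
  exact (recordOf h V h4).smooth K

/-- The total record functor's values are projective over `F` for `4 ≤ [F:ℚ]` (the chosen record's (F1) field
`RecordSystem.projective`: `V.Hm` anisotropic, compact Shimura surfaces; along `recordFunctorOf_eq`).
[cite: Deligne1979ShimuraVarieties, 2.2.5 and Cor. 2.7.21] -/
theorem projective_recordFunctorOf_obj (h4 : 4 ≤ Module.finrank ℚ F) (K : C5.SmallLevel (K3 V)) :
    IsProjectiveOver ((recordFunctorOf h V).obj K) := by
  rw [recordFunctorOf_eq h V h4]
  exact (recordOf h V h4).projective K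

/-- `Sh(𝕍)_K = X_K` of the honest system is smooth over `F` of relative dimension `n − 1 = 2` for `4 ≤ [F:ℚ]` ([Liu2021] l. 4656
«smooth … of dimension `n − 1`»; base change of the record's (F1), Liu 2002 Prop. 4.3.38). [cite: Liu2021, App. C l. 4656]
[cite: Liu2002, Prop. 4.3.38] -/
theorem smooth_honestSystemOf_Sh (h4 : 4 ≤ Module.finrank ℚ F) (K : C5.SmallLevel (honestSystemOf h V Φ).K₀) :
    SmoothOfRelativeDimension ((honestP5Of h F ι₁ V Φ).n - 1) ((honestSystemOf h V Φ).Sh𝕍.obj K).hom :=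
  smooth_conjSystem_obj V (K3 V) (recordFunctorOf h V) (smooth_recordFunctorOf_obj h V h4) K

/-- `Sh(𝕍)_K = X_K` of the honest system is projective over `F` for `4 ≤ [F:ℚ]` ([Liu2021] l. 4656 «It is projective if `d > 1`»;
base change of the record's (F1), Liu 2002 Prop. 3.1.23). [cite: Liu2021, App. C l. 4656] [cite: Liu2002, Prop. 3.1.23 and Ex. 3.1.10] -/
theorem projective_honestSystemOf_Sh (h4 : 4 ≤ Module.finrank ℚ F) (K : C5.SmallLevel (honestSystemOf h V Φ).K₀) :
    IsProjectiveOver ((honestSystemOf h V Φ).Sh𝕍.obj K) :=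
  projective_conjSystem_obj V (K3 V) (recordFunctorOf h V) (projective_recordFunctorOf_obj h V h4) K

/-- **Def. C.8 on the total honest datum in the Compact Case** (`4 ≤ [F:ℚ]`): `\overline{Sh} := S̃h := X := Sh(𝕍)`, identity
comparison maps, empty boundary ([Liu2021] l. 4656; b11's `CompactifiedSystem.ofProjective`). [cite: Liu2021, App. C l. 4656 and Def. C.8] -/
def compactifiedOf (h4 : 4 ≤ Module.finrank ℚ F) : CompactifiedSystem (honestSystemOf h V Φ) :=
  CompactifiedSystem.ofProjective (honestSystemOf h V Φ) (smooth_honestSystemOf_Sh h V Φ h4)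
    (projective_honestSystemOf_Sh h V Φ h4)

/-! ## §2  The Compact-Case clause and the non-vacuity certificate -/

/-- `d = [F⁺:ℚ] ≠ 1` for a CM field with `4 ≤ [F:ℚ]` (`[F:ℚ] = 2·[F⁺:ℚ]`): the chain's faces are in Liu's Compact Case
([Liu2021] §4.2 l. 2055–2057). [cite: Liu2021, §4.2 l. 2053–2057] -/
theorem finrank_maximalRealSubfield_ne_one (h4 : 4 ≤ Module.finrank ℚ F) :
    Module.finrank ℚ (maximalRealSubfield F) ≠ 1 := by
  intro h1
  have hmul := Module.finrank_mul_finrank ℚ (maximalRealSubfield F) F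
  rw [Algebra.IsQuadraticExtension.finrank_eq_two (maximalRealSubfield F) F, h1] at hmul
  omega

/-- «It is projective if and only if we are in the Compact Case» ([Liu2021] §4.2 l. 2060) for the honest system at `4 ≤ [F:ℚ]`:
both sides hold. [cite: Liu2021, §4.2 l. 2053–2060] -/
theorem isProjectiveOver_honestSystemOf_Sh_iff (h4 : 4 ≤ Module.finrank ℚ F) (iso : ℕ → Prop)
    (K : C5.SmallLevel (honestSystemOf h V Φ).K₀) :
    IsProjectiveOver ((honestSystemOf h V Φ).Sh𝕍.obj K) ↔
      ¬ (Module.finrank ℚ (maximalRealSubfield F) = 1 ∧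
        (3 ≤ (honestP5Of h F ι₁ V Φ).n ∨ ((honestP5Of h F ι₁ V Φ).n = 2 ∧ ∀ p : ℕ, p.Prime → iso p))) :=
  ⟨fun _ hh => finrank_maximalRealSubfield_ne_one h4 hh.1, fun _ => projective_honestSystemOf_Sh h V Φ h4 K⟩

/-- **NON-VACUITY of the posited carrier binder `C` of the closed `hComp` term, fibrewise on `4 ≤ [F:ℚ]`**: given the two cited
existence theorems — Deligne's canonical models (`h`, [Deligne1979] 2.2.5 / Cor. 2.7.21) and [Liu2021] §2.1 Proposition
(`hA : exists_albanese`: every proper smooth scheme over a field has an Albanese datum, Def. 2.3) — Liu's §4.2 standing data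
`Sec42Data (honestP5Of h F ι₁ V Φ) iso` EXIST for every isotropy token `iso`: «`n ≥ 2`» (`n = 3`), the system of Shimura varieties
`honestSystemOf` (Prop. C.5 constructed), «projective iff Compact Case» (both true, `d ≠ 1`), the compactified system
(`compactifiedOf`, `X_K = Sh(𝕍)_K`) and Albanese data of the proper smooth `X_K` chosen from `hA` — the tree assembly
`AppendixC.Sec42Data.nonempty_of_exists_albanese`.  So no END display over `C` at `P5 := honestP5Of h` is vacuous at the faces the
chain reads.  CONDITIONAL on `h`, `hA`; nothing about Liu's ACTUAL `Sh(𝕍)_K`/`A_K` is asserted (the closed term still takes `C` as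
a binder, hcomp-ref R-2); HC_CM is NOT proved. [cite: Liu2021, §4.2 l. 2053–2070, §2.1 Proposition l. 1190–1192, App. C l. 4656]
[cite: Deligne1979ShimuraVarieties, 2.2.5 and Cor. 2.7.21] -/
theorem nonempty_sec42Data_honestP5Of (hA : exists_albanese) (h4 : 4 ≤ Module.finrank ℚ F) (iso : ℕ → Prop) :
    Nonempty (Sec42Data (honestP5Of h F ι₁ V Φ) iso) :=
  Sec42Data.nonempty_of_exists_albanese hA iso (Nat.le_of_ble_eq_true rfl) (honestSystemOf h V Φ)
    (isProjectiveOver_honestSystemOf_Sh_iff h V Φ h4 iso) (compactifiedOf h V Φ h4)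

/-- The same for every face of the chain (`6 ≤ [F:ℚ]`, the guard of `hUnif`/`hAlb`/`hComp`). [cite: Liu2021, §4.2 l. 2053–2070] -/
theorem nonempty_sec42Data_honestP5Of_of_six_le (hA : exists_albanese) (h6 : 6 ≤ Module.finrank ℚ F) (iso : ℕ → Prop) :
    Nonempty (Sec42Data (honestP5Of h F ι₁ V Φ) iso) :=
  nonempty_sec42Data_honestP5Of h V Φ hA (le_trans (by norm_num) h6) iso

end Summit.HodgeConjecture.CorCM.Model
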